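import Summits.FinalStateConjecture.FinalStateConjecture.Theorems.PhotonSphereChannelsTameHullDefs
import Summits.FinalStateConjecture.FinalStateConjecture.Theorems.ChannelsResolveTameDevelopmentsR.Negative.MinkowskiEndVisible
import Literature.Geometry.Lorentzian.SpacetimeLocalConvergenceIsometry
import Literature.Geometry.Lorentzian.MinkowskiGlobalHyperbolicity
import Literature.Geometry.Lorentzian.MinkowskiCauchyDevelopment
import Summits.FinalStateConjecture.FinalStateConjecture.Theorems.ZeroEnergyRigidity.Negative.MinkowskiPresentation
import HarnessLib

/-!
# Route PhotonSphereChannels · crux `ChannelsResolveTameDevelopments R` (K2R-T2, stmt-FinalStateConjecture-17430) —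
# the hull of the Minkowski MGHD contains the flat end (first `IsHullElement` instance)

Companion of `…RFlatTameEnd.lean` (the flat end `E` of Minkowski spacetime is a `(Λ, r₀)`-tame silent
end for every class). Here: along the time axis `qₙ = ((n+1), 0, 0, 0)` of the Minkowski vacuum Cauchy
development of the trivial datum, the pointed developments `(𝒟, qₙ)` converge in the pointed `C²`
(Cheeger–Gromov) sense to `(ℝ⁴₁, 0)` — the time translations `x ↦ x + qₙ` are time-oriented
isometries of `η`, so the constant self-limit (`SubconvergesLocallyTo.refl`) pushes forward
(`SubconvergesLocallyTo.of_source_isometry`) — and `qₙ` is FUTURE-ESCAPING: each `qₙ` is an outer point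
(`J⁺(Σ)`, and end-visible by `minkowski_isEndVisibleEvent_of_time_nonneg`) and leaves the causal past of
every compact set (`J⁻(K) ⊆ {x⁰ ≤ max_K x⁰}`, `Minkowski.causalPast_singleton`). Hence every tame end datum
`E` of Minkowski spacetime is a HULL ELEMENT of the Minkowski development
(`isHullElement_minkowski_of_isTameEnd`): `TameHull.IsHullElement` is inhabited, and with
`…RFlatTameEnd.exists_isTameEnd_minkowski` the hull of the one certified MGHD meets the flat branch —
the `NonEmptiness` residual (`N`, line `dark-future-exactness`) at the model point.

All results proved; no named facts; no definitions.

## References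

* P. Petersen, *Riemannian Geometry*, 2nd ed. (2006), Ch. 10, §3.2 (pointed convergence). [Petersen2006]
* M. T. Anderson, Cheeger–Gromov theory and applications to general relativity (2004), Def. 1.1. [Anderson2004]
* B. O'Neill, *Semi-Riemannian geometry* (1983), Ch. 14, p. 402 (causality of `ℝ⁴₁`). [ONeill1983]
-/

noncomputable section

set_option maxSynthPendingDepth 3
set_option linter.dupNamespace false

open Set Filter Function TopologicalSpace Manifold Bundle
open scoped Topology Manifold ContDiff ENNReal NNReal

namespace Summit.FinalStateConjecture.FinalStateConjecture.Theorems.TameHull.FlatEnd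

open Literature.Geometry.Lorentzian
open Summit.FinalStateConjecture.FinalStateConjecture.Theorems.ChannelsResolveTameDevelopmentsR.MinkowskiModel
open Summit.FinalStateConjecture.FinalStateConjecture.Theorems.ZeroEnergyRigidity.Negative

/-! ## §1 Time translations push the constant self-limit of Minkowski spacetime along any base sequence -/

/-- **Pointed `Cᵏ_loc` convergence of Minkowski spacetime along ANY sequence of base points**:
`(ℝ⁴₁, cₙ) ⇀ (ℝ⁴₁, 0)` for every `c : ℕ → ℝ⁴` and every `k` — the translations `x ↦ x + cₙ` are
time-oriented isometries of `(ℝ⁴, η, ∂ₜ)` (`dT = id`, `η` and `∂ₜ` constant), applied to the constant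
self-limit `SubconvergesLocallyTo.refl`. [cite: Petersen2006, Ch. 10 §3.2] -/
theorem subconvergesLocallyTo_minkowski_translates (c : ℕ → E4) (k : ℕ) :
    Spacetime.SubconvergesLocallyTo (fun _ : ℕ ↦ Minkowski.spacetime) (fun n ↦ (c n : E4))
      Minkowski.spacetime (0 : E4) k := by
  -- the translation diffeomorphisms
  let T : E4 → Diffeomorph 𝓘(ℝ, E4) 𝓘(ℝ, E4) E4 E4 ∞ := fun a ↦
    { toEquiv := Equiv.addRight a
      contMDiff_toFun := contMDiff_iff_contDiff.2 (contDiff_id.add contDiff_const)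
      contMDiff_invFun := contMDiff_iff_contDiff.2 (contDiff_id.add contDiff_const) }
  have hT : ∀ (a : E4) (z : E4), T a z = z + a := fun _ _ ↦ rfl
  have hdT : ∀ (a y : E4), mfderiv 𝓘(ℝ, E4) 𝓘(ℝ, E4) (T a) y = ContinuousLinearMap.id ℝ E4 := by
    intro a y
    have h : (⇑(T a) : E4 → E4) = fun z ↦ z + a := funext (hT a)
    rw [h]
    exact ((hasFDerivAt_id y).add_const a).hasMFDerivAt.mfderiv
  have h := Spacetime.SubconvergesLocallyTo.of_source_isometry
    (𝓢ₙ := fun _ : ℕ ↦ Minkowski.spacetime) (𝓢'ₙ := fun _ : ℕ ↦ Minkowski.spacetime)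
    (Spacetime.SubconvergesLocallyTo.refl Minkowski.spacetime (0 : E4) k) (fun n ↦ T (c n))
    (fun n y ↦ by
      ext v w
      rw [pullbackBilin_apply]
      erw [hdT]
      rfl)
    (fun n y ↦ by
      change (TimeOrientation.ofLE (n' := (∞ : ℕ∞ω)) Minkowski.timeOrientation le_top).IsFutureDirected
        (x := T (c n) y) (mfderiv 𝓘(ℝ, E4) 𝓘(ℝ, E4) (T (c n)) y (E4.basisVector 0))
      rw [hdT]
      exact (TimeOrientation.ofLE (n' := (∞ : ℕ∞ω)) Minkowski.timeOrientation le_top).isFutureDirected_vectorField _)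
  refine (congrArg (fun f : ℕ → E4 ↦ Spacetime.SubconvergesLocallyTo (fun _ : ℕ ↦ Minkowski.spacetime) f
    Minkowski.spacetime (0 : E4) k) ?_).mp h
  funext n
  exact (hT _ _).trans (zero_add _)

/-! ## §2 The outer region of the Minkowski development is the closed future half-space; no event horizon -/

/-- **The causal future of the slice of the Minkowski development is the closed upper half-space**
`J⁺(Σ) = {x | 0 ≤ x⁰}` (`J⁺(0, y) = {x | ‖x̲ − y‖ ≤ x⁰}`). [cite: ONeill1983, Ch. 14, p. 402] -/
theorem causalFuture_range_embed_minkowski :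
    (LorentzianMetric.ofLE (n' := (∞ : ℕ∞ω)) Minkowski.metric le_top).causalFuture
      (TimeOrientation.ofLE (n' := (∞ : ℕ∞ω)) Minkowski.timeOrientation le_top)
        (Set.range Minkowski.sliceEmbed) = {x : E4 | 0 ≤ x 0} := by
  ext x
  constructor
  · intro hx
    rw [LorentzianMetric.causalFuture_eq_biUnion] at hx
    obtain ⟨p, ⟨y, rfl⟩, hxp⟩ := mem_iUnion₂.1 hx
    rw [Minkowski.causalFuture_singleton] at hxp
    have h := (norm_nonneg _).trans (show _ ≤ x 0 - (Minkowski.sliceEmbed y : E4) 0 from hxp)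
    rw [Minkowski.sliceEmbed_apply, E4.ofTimeSpace_apply_zero, sub_zero] at h
    exact h
  · intro hx
    have hp : (E4.ofTimeSpace 0 (E4.spatial x) : E4) ∈ Set.range Minkowski.sliceEmbed :=
      ⟨⟨E4.spatial x, trivial⟩, rfl⟩
    refine LorentzianMetric.causalFuture_mono (singleton_subset_iff.2 hp) ?_
    rw [Minkowski.causalFuture_singleton]
    simp only [mem_setOf_eq, E4.spatial_ofTimeSpace, sub_self, norm_zero, E4.ofTimeSpace_apply_zero,
      sub_zero]
    exact hx

/-- **Every event on or above the slice is an OUTER point of the Minkowski development**: it lies in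
`J⁺(Σ)` and is visible from infinity along a far-launched complete ray
(`minkowski_isEndVisibleEvent_of_time_nonneg`). [cite: HawkingEllis1973, §9.2] -/
theorem mem_outerRegion_minkowski_of_time_nonneg [Minkowski.vacuumCauchyDevelopment.metric.HasLeviCivita]
    {x : E4} (hx : 0 ≤ x 0) : (x : Minkowski.vacuumCauchyDevelopment.carrier) ∈
      outerRegion Minkowski.vacuumCauchyDevelopment := by
  refine ⟨?_, (minkowski_isEndVisibleEvent_of_time_nonneg hx).isVisibleEvent⟩
  change x ∈ (LorentzianMetric.ofLE (n' := (∞ : ℕ∞ω)) Minkowski.metric le_top).causalFuture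
    (TimeOrientation.ofLE (n' := (∞ : ℕ∞ω)) Minkowski.timeOrientation le_top) (Set.range Minkowski.sliceEmbed)
  rw [causalFuture_range_embed_minkowski]
  exact hx

/-- **The outer region of the Minkowski development is exactly the closed upper half-space**
`{x | 0 ≤ x⁰}` (hypothesis (ii)'s `outer`, the `TameHull.outerRegion` of the crux): `⊆` because the outer
region lies in `J⁺(Σ)`, `⊇` by `mem_outerRegion_minkowski_of_time_nonneg`. [cite: HawkingEllis1973, §9.2] -/
theorem outerRegion_minkowski_eq [Minkowski.vacuumCauchyDevelopment.metric.HasLeviCivita] :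
    outerRegion Minkowski.vacuumCauchyDevelopment = {x : E4 | 0 ≤ x 0} := by
  refine Set.Subset.antisymm (fun x hx ↦ ?_) (fun x hx ↦ mem_outerRegion_minkowski_of_time_nonneg hx)
  have h1 : (x : E4) ∈ (LorentzianMetric.ofLE (n' := (∞ : ℕ∞ω)) Minkowski.metric le_top).causalFuture
      (TimeOrientation.ofLE (n' := (∞ : ℕ∞ω)) Minkowski.timeOrientation le_top)
        (Set.range Minkowski.sliceEmbed) := hx.1
  rw [causalFuture_range_embed_minkowski] at h1
  exact h1

/-- **Everything lies in the chronological past of the outer region**: `I⁻(outer) = ℝ⁴` (from `x` go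
straight up to `(|x⁰| + 1 + x⁰ … )`: the point `x + (|x⁰| + 1) ∂ₜ` is outer). [cite: ONeill1983, Ch. 14, p. 402] -/
theorem chronologicalPast_outerRegion_minkowski_eq_univ [Minkowski.vacuumCauchyDevelopment.metric.HasLeviCivita] :
    Minkowski.vacuumCauchyDevelopment.metric.chronologicalPast Minkowski.vacuumCauchyDevelopment.timeOrientation
      (outerRegion Minkowski.vacuumCauchyDevelopment) = Set.univ := by
  refine Set.eq_univ_of_forall fun x' ↦ ?_
  obtain ⟨x, rfl⟩ : ∃ x : E4, x = x' := ⟨x', rfl⟩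
  rw [LorentzianMetric.mem_chronologicalPast_iff_exists]
  refine ⟨E4.ofTimeSpace (|x 0| + 1 + ‖(0 : E3) - E4.spatial x‖) 0,
    mem_outerRegion_minkowski_of_time_nonneg ?_, ofTimeSpace_mem_chronologicalFuture x 0 ?_⟩
  · rw [E4.ofTimeSpace_apply_zero]
    positivity
  · have := le_abs_self (x 0)
    linarith

/-- **The Minkowski development has NO event horizon** (with respect to the crux's outer region):
`𝓗⁺ = ∂I⁻(outer) ∩ J⁺(Σ) = ∂ℝ⁴ ∩ J⁺(Σ) = ∅` — so the new line's `horizonOf` is empty at the model point,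
it has no horizon generator paths, and every clause quantified over them holds there vacuously.
[cite: HawkingEllis1973, §9.2] -/
theorem eventHorizonOf_outerRegion_minkowski_eq_empty : ∀ [Minkowski.vacuumCauchyDevelopment.metric.HasLeviCivita], Minkowski.vacuumCauchyDevelopment.toCauchyDevelopment.eventHorizonOf (outerRegion Minkowski.vacuumCauchyDevelopment) = ∅ := by
  intro _
  rw [CauchyDevelopment.eventHorizonOf]
  change frontier (Minkowski.vacuumCauchyDevelopment.metric.chronologicalPast
      Minkowski.vacuumCauchyDevelopment.timeOrientation (outerRegion Minkowski.vacuumCauchyDevelopment)) ∩ _ = ∅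
  rw [chronologicalPast_outerRegion_minkowski_eq_univ, frontier_univ, Set.empty_inter]

/-! ## §3 Future-escaping sequences of the Minkowski development -/

/-- **The causal past of a compact set of Minkowski spacetime is bounded in `x⁰ + ‖x̲‖`**: if
`x ∈ J⁻(K)`, `K` compact, then `x⁰ + ‖x̲‖ ≤ max_K (y⁰ + ‖y̲‖)` (`J⁻(y)` is the solid past cone
`‖y̲ − x̲‖ ≤ y⁰ − x⁰`). [cite: ONeill1983, Ch. 14, p. 402] -/
theorem time_add_norm_le_of_mem_causalPast_minkowski {K : Set E4} (hK : IsCompact K) :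
    ∃ T : ℝ, ∀ x : E4, x ∈ (LorentzianMetric.ofLE (n' := (∞ : ℕ∞ω)) Minkowski.metric le_top).causalPast
      (TimeOrientation.ofLE (n' := (∞ : ℕ∞ω)) Minkowski.timeOrientation le_top) K →
        x 0 + ‖E4.spatial x‖ ≤ T := by
  obtain ⟨T, hT⟩ := hK.bddAbove_image (f := fun y : E4 ↦ y 0 + ‖E4.spatial y‖)
    (((PiLp.continuous_apply 2 (fun _ : Fin 4 ↦ ℝ) 0).add (E4.spatial.continuous.norm)).continuousOn)
  refine ⟨T, fun x hx ↦ ?_⟩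
  -- `J⁻(K) = ⋃_{y ∈ K} J⁻(y)` (time dual of `causalFuture_eq_biUnion`)
  have hx' : x ∈ (LorentzianMetric.ofLE (n' := (∞ : ℕ∞ω)) Minkowski.metric le_top).causalFuture
      (TimeOrientation.ofLE (n' := (∞ : ℕ∞ω)) Minkowski.timeOrientation le_top).reverse K := hx
  rw [LorentzianMetric.causalFuture_eq_biUnion] at hx'
  obtain ⟨y, hy, hxy⟩ := mem_iUnion₂.1 hx'
  have hxy' : x ∈ (LorentzianMetric.ofLE (n' := (∞ : ℕ∞ω)) Minkowski.metric le_top).causalPast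
      (TimeOrientation.ofLE (n' := (∞ : ℕ∞ω)) Minkowski.timeOrientation le_top) {y} := hxy
  rw [Minkowski.causalPast_singleton] at hxy'
  have h1 : x 0 + ‖E4.spatial x‖ ≤ y 0 + ‖E4.spatial y‖ := by
    have h2 : ‖E4.spatial x‖ ≤ ‖E4.spatial y‖ + ‖E4.spatial y - E4.spatial x‖ := by
      have := norm_sub_norm_le (E4.spatial x) (E4.spatial y)
      rw [norm_sub_rev] at this
      linarith
    have h3 : ‖E4.spatial y - E4.spatial x‖ ≤ y 0 - x 0 := hxy'
    linarith
  exact h1.trans (hT (mem_image_of_mem _ hy))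

/-- **Future-escaping sequences of the Minkowski development, characterised**: a sequence `q` is
future-escaping (`TameHull.IsFutureEscaping`: outer points eventually leaving `J⁻(K)` for every compact
`K`) iff every `qₙ` lies on or above the slice and `qₙ⁰ + ‖q̲ₙ‖ → +∞` (escape to `i⁺`, `𝓘⁺` OR `i⁰`:
the definition does not distinguish). [cite: ONeill1983, Ch. 14, p. 402] -/
theorem isFutureEscaping_minkowski_iff : ∀ [Minkowski.vacuumCauchyDevelopment.metric.HasLeviCivita] (q : ℕ → E4), IsFutureEscaping Minkowski.vacuumCauchyDevelopment (fun n ↦ (q n : Minkowski.vacuumCauchyDevelopment.carrier)) ↔ (∀ n, 0 ≤ q n 0) ∧ Tendsto (fun n ↦ q n 0 + ‖E4.spatial (q n)‖) atTop atTop := by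
  intro _ q
  constructor
  · rintro ⟨hout, hesc⟩
    have h0 : ∀ n, 0 ≤ q n 0 := fun n ↦ by
      have h := hout n
      rw [outerRegion_minkowski_eq] at h
      exact h
    refine ⟨h0, ?_⟩
    rw [tendsto_atTop_atTop]
    intro b
    -- the compact slab piece `K_b = {0 ≤ x⁰ ≤ b, ‖x̲‖ ≤ b}` ⊆ `J⁻(K_b)` is eventually avoided
    set Kb : Set E4 := {x | 0 ≤ x 0 ∧ x 0 ≤ b ∧ ‖E4.spatial x‖ ≤ b} with hKb
    have hKc : IsCompact Kb := by
      refine Metric.isCompact_of_isClosed_isBounded ?_ ?_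
      · exact (isClosed_le continuous_const (PiLp.continuous_apply 2 _ 0)).inter
          ((isClosed_le (PiLp.continuous_apply 2 _ 0) continuous_const).inter
            (isClosed_le E4.spatial.continuous.norm continuous_const))
      · rw [Metric.isBounded_iff_subset_closedBall (0 : E4)]
        refine ⟨|b| + |b|, fun x ⟨hx0, hx1, hx2⟩ ↦ ?_⟩
        rw [Metric.mem_closedBall, dist_zero_right]
        have hsq := Minkowski.norm_sq_eq_time_sq_add_norm_spatial_sq x
        have hb : x 0 ≤ |b| := hx1.trans (le_abs_self b)
        have hb' : ‖E4.spatial x‖ ≤ |b| := hx2.trans (le_abs_self b)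
        nlinarith [norm_nonneg x, norm_nonneg (E4.spatial x), abs_nonneg b]
    obtain ⟨N, hN⟩ := eventually_atTop.1 (hesc Kb hKc)
    refine ⟨N, fun n hn ↦ ?_⟩
    by_contra hlt
    rw [not_le] at hlt
    have hmem : q n ∈ Kb := ⟨h0 n, by linarith [norm_nonneg (E4.spatial (q n))],
      by linarith [h0 n]⟩
    exact hN n hn (Or.inl hmem)
  · rintro ⟨h0, htend⟩
    refine ⟨fun n ↦ mem_outerRegion_minkowski_of_time_nonneg (h0 n), fun K hK ↦ ?_⟩
    obtain ⟨T, hT⟩ := time_add_norm_le_of_mem_causalPast_minkowski (K := K) hK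
    filter_upwards [htend.eventually (eventually_gt_atTop T)] with n hn
    intro hmem
    have h := hT _ hmem
    linarith

/-- **The time axis `qₙ = (n+1, 0)` of the Minkowski development is future-escaping.**
[cite: ONeill1983, Ch. 14, p. 402] -/
theorem isFutureEscaping_timeAxis_minkowski [Minkowski.vacuumCauchyDevelopment.metric.HasLeviCivita] :
    IsFutureEscaping Minkowski.vacuumCauchyDevelopment
      (fun n : ℕ ↦ (E4.ofTimeSpace ((n : ℝ) + 1) 0 : E4)) := by
  rw [isFutureEscaping_minkowski_iff]
  refine ⟨fun n ↦ ?_, ?_⟩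
  · rw [E4.ofTimeSpace_apply_zero]; positivity
  · simp only [E4.ofTimeSpace_apply_zero, E4.spatial_ofTimeSpace, norm_zero, add_zero]
    exact tendsto_atTop_add_const_right _ _ tendsto_natCast_atTop_atTop

/-! ## §4 Every tame end of Minkowski spacetime is a hull element of the Minkowski development, along
## every future-escaping sequence -/

/-- **Every `(Λ, r₀)`-tame end datum of Minkowski spacetime is a HULL ELEMENT of the Minkowski vacuum
Cauchy development along EVERY future-escaping base sequence** (limit `(ℝ⁴₁, 0)`, §1).
[cite: Anderson2004, Def. 1.1] -/
theorem isHullElement_minkowski_of_isFutureEscaping [Minkowski.vacuumCauchyDevelopment.metric.HasLeviCivita]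
    {Λ : ℝ≥0} {r₀ : ℝ} {E : EndDatum Minkowski.spacetime} (hE : E.IsTameEnd Λ r₀) {q : ℕ → E4}
    (hq : IsFutureEscaping Minkowski.vacuumCauchyDevelopment
      (fun n ↦ (q n : Minkowski.vacuumCauchyDevelopment.carrier))) :
    IsHullElement Minkowski.vacuumCauchyDevelopment Λ r₀
      (fun n ↦ (q n : Minkowski.vacuumCauchyDevelopment.carrier)) Minkowski.spacetime E (0 : E4) :=
  ⟨hq, hE, subconvergesLocallyTo_minkowski_translates q 2⟩

/-! ## §5 The registered form: the time axis -/

/-- **Every `(Λ, r₀)`-tame end datum of Minkowski spacetime is a HULL ELEMENT of the Minkowski vacuum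
Cauchy development** (first inhabitant of `TameHull.IsHullElement`): base sequence the time axis
`qₙ = (n+1, 0)` (future-escaping, §2), limit `(ℝ⁴₁, 0)` in pointed `C²` (§1; the development's spacetime
IS `Minkowski.spacetime`). With `…RFlatTameEnd.exists_isTameEnd_minkowski` (the flat end is tame and
silent in every class) the hull of the one certified MGHD of the one certified admissible datum meets the
flat branch of the dichotomy — NonEmptiness at the model point. [cite: Anderson2004, Def. 1.1] -/
theorem isHullElement_minkowski_of_isTameEnd : ∀ [Minkowski.vacuumCauchyDevelopment.metric.HasLeviCivita] {Λ : ℝ≥0} {r₀ : ℝ} {E : EndDatum Minkowski.spacetime}, E.IsTameEnd Λ r₀ → IsHullElement Minkowski.vacuumCauchyDevelopment Λ r₀ (fun n : ℕ ↦ (E4.ofTimeSpace ((n : ℝ) + 1) 0 : E4)) Minkowski.spacetime E (0 : E4) := by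
  intro _ Λ r₀ E hE
  exact ⟨isFutureEscaping_timeAxis_minkowski, hE,
    subconvergesLocallyTo_minkowski_translates (fun n : ℕ ↦ E4.ofTimeSpace ((n : ℝ) + 1) 0) 2⟩

end Summit.FinalStateConjecture.FinalStateConjecture.Theorems.TameHull.FlatEnd

end
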